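import Summits.BirchSwinnertonDyer.BirchSwinnertonDyer.Theorems.SylvesterTwoHeegnerIndexUpperOffV0KolyvaginTwoHSY
import Summits.BirchSwinnertonDyer.BirchSwinnertonDyer.Theorems.SylvesterTwoHeegnerIndexUpperOffV0ShaBoundTwoSharp
import Summits.BirchSwinnertonDyer.BirchSwinnertonDyer.Theorems.SylvesterTwoHeegnerIndexUpperOffV0ReciprocityFinsetTwoOfPoitouTate
import Summits.BirchSwinnertonDyer.BirchSwinnertonDyer.Theorems.SylvesterTwoHeegnerIndexUpperOffV0ShaBoundTwoOmega
import HarnessLib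

/-!
# K7t crux `UpperOffV0HSYPlus` (item 19804), line `offv0-kolyvagin2`: the line's terminal statements ON
# THE CLASS 𝒞_HSY, SHARP — Kolyvagin AT `p = 2` with exponent `2^{M₀+2}` from Poitou–Tate and the five
# printed inputs of the odd-`p` road

Helper file of route `SylvesterTwoHeegnerIndex` (cell bsd-cm, rung K7t).  k7t-c2 g6's
`…UpperOffV0KolyvaginTwoHSY` states the line's chain on 𝒞_HSY (`p ≡ 4, 7 (mod 9)`): Poitou–Tate
(named fact, cite-only) + the five cite-only printed inputs {`hrec`, `hCM`, `h53`, `hGZ`, `hγ`} ⟹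
`2^{M₀} ∥ y_K` and `Ш(E_p/K)[2^∞]` (resp. `Ш(E_p/ℚ)[2^∞]` in twist-rank-`0` frames) finite and killed
by `2^{2M₀+4}`.  THIS FILE is the SHARP twin (k7t-c2 g8): the same labelled inputs give the exponent
**`2^{M₀+2}`**, because Poitou–Tate yields not only the one-place reciprocity (R)_M of stub (e) but the
finset form (R_T)_M (`kolyvaginReciprocityFinsetM_of_poitouTate_anyPrime`,
`…UpperOffV0ReciprocityFinsetTwoOfPoitouTate`), and the two-place duality it feeds removes the
doubling `2M₀` and the socle `+1` of the generic count (`DescentDefect.descent_sharp_defect`,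
`…UpperOffV0DescentSharp`; `descentTwoSharp_of_leaves`; `sha_two_primary_exponent_sharp_of_pointsM_of_reciprocityFinsetM`).

* `sha_two_primary_exponent_sharp_HSY_of_poitouTate` — over the Heegner field `K`;
* `sha_two_primary_exponent_sharp_HSY_rat_of_poitouTate` — over `ℚ` in a twist-rank-`0` frame.

HONEST FRAMING: composition; trust base EXACTLY {PT, `hrec`, `hCM`, `h53`, `hGZ`, `hγ`} as in the
landed twin; the remaining `+2` above Kolyvagin's `C = 2^{M₀}` (Lemma 5.3 at `2`, decomposition) is
intrinsic to `τ`-eigen Heegner classes (k7t-c2 g5 §5, g7 ISOTROPY p494364); stub (U1) is NOT reached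
(margin `4 + ord₂ #Ш_an(E_p^{(d_K)}) + 2t_K` by the frame identity; seat memo
K7T-UPPER-SHARP-k7t-c2-g8.md); NOT the crux's order bound (B14 = O12 open as a class); no definition,
no named fact, no `sorry`; BSD not claimed.  References: [GrossLMS1991] §3–§6, Thm. 1.3 (2);
[McCallumLMS1991] §1, §2 Prop. 2.2, §4–§5; [MilneADT2006] I Thm. 4.10(b).
-/

set_option autoImplicit false
set_option linter.dupNamespace false

noncomputable section

open scoped Classical
open WeierstrassCurve Field NumberField IsDedekindDomain Finset
open Literature.NumberTheory.EllipticCurves Literature.NumberTheory.GaloisRepresentations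
open Literature.NumberTheory.EllipticCurves.KolyvaginCocycle
open Literature.NumberTheory.EllipticCurves.KolyvaginEuler
open Literature.NumberTheory.EllipticCurves.RingClassField
open Literature.NumberTheory.EllipticCurves.ModularForms
open Literature.NumberTheory.GaloisCohomology
open Summit.BirchSwinnertonDyer.Rank1Residual.X11b
open Summit.BirchSwinnertonDyer.Rank1Residual.X11b.KolyvaginAssembly

namespace Summit.BirchSwinnertonDyer.BirchSwinnertonDyer.Theorems.SylvesterTwoUpper

-- `K : Type`: the tree's ring-class class field theory is universe `0`.
variable {K : Type} [Field K] [NumberField K] {N : ℕ} {W : WeierstrassCurve ℚ}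

/-- **The line's chain on 𝒞_HSY, SHARP: Poitou–Tate + {`hrec`, `hCM`, `h53`, `hGZ`, `hγ`} ⟹ `Ш(E_p/K)[2^∞]`
finite and killed by `2^{M₀+2}`** (`p ≡ 4, 7 (mod 9)`, `W` globally minimal at its conductor, Heegner
frame; `2^{M₀} ∥ y_K` in `E_p(K)`): (d″) at the frame from the five printed inputs
(`hpoints_at_two_of_perLevelChoice_HSY`), the finset reciprocity (R_T)_M from Poitou–Tate
(`kolyvaginReciprocityFinsetM_of_poitouTate_anyPrime`), and the sharp count
`sha_two_primary_exponent_sharp_of_pointsM_of_reciprocityFinsetM`; `∛(432p²) ∉ K`, `ω ∉ K`,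
`E_p(K)[2] = 0` discharged as in the landed twin (exponent `2^{2M₀+4}`, same labelled inputs).
[cite: McCallumLMS1991, §1 Theorem (Kolyvagin)] [cite: GrossLMS1991, Thm. 1.3 (2)] [cite: MilneADT2006, Ch. I Thm. 4.10(b)] -/
theorem sha_two_primary_exponent_sharp_HSY_of_poitouTate [NeZero N]
    [W.IsGloballyMinimal] [W.IsElliptic]
    (hN : N = W.conductorNorm ℤ) (hK : IsImaginaryQuadratic K)
    (hD34 : NumberField.discr K ≠ -3 ∧ NumberField.discr K ≠ -4)
    (hH : SatisfiesHeegnerHypothesis N K) {P : (W.baseChange K).toAffine.Point}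
    (hHP : IsHeegnerPoint N W K P) (hnt : ¬ IsOfFinAddOrder P) {p : ℕ} (hp : p.Prime) (hp2 : p ≠ 2)
    (h9 : p % 9 = 4 ∨ p % 9 = 7)
    (hW : ∃ C : VariableChange ℚ, C • W = HuShuYin2019.cubeSumCurve (p : ℚ))
    (hPT : poitouTate_sum_localTatePairing_eq_zero K)
    (hrec : heegnerPointOfConductor_one_galoisConj N W K)
    (hCM : ∀ [W.IsElliptic] (_hK : IsImaginaryQuadratic K) (_hH : SatisfiesHeegnerHypothesis N K)
      (Dt : ModularParametrizationData W N) (β : ℤ) (ι : K →+* ℂ),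
      (4 * N : ℤ) ∣ β ^ 2 - NumberField.discr K →
      ∀ {M : ℕ}, 1 ≤ M → ∀ (m : ℕ), Squarefree m →
      (∀ q ∈ m.primeFactors, IsKolyvaginPrime N W K 2 q ∧ FrobEqFrobInfty W K (2 ^ M) q) →
      ∃ y : (W.baseChange (ringClassField K ι m)).toAffine.Point,
        WeierstrassCurve.Affine.Point.map (W' := W) (ringClassField K ι m).subtype.toRatAlgHom y =
          heegnerPointComplexOfConductor Dt (NumberField.discr K) β m)
    (h53 : ∀ [W.IsElliptic] (_hK : IsImaginaryQuadratic K) (_hH : SatisfiesHeegnerHypothesis N K)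
      (Dt : ModularParametrizationData W N) (β : ℤ) (ι : K →+* ℂ) {M : ℕ}
      (_hM : 1 ≤ M) {n : ℕ} (_hn : Squarefree n)
      (_hKol : ∀ q ∈ n.primeFactors, IsKolyvaginPrime N W K 2 q ∧ FrobEqFrobInfty W K (2 ^ M) q)
      (d : (m : ℕ) → m ∣ n → KolyvaginHeegnerData Dt β ι m) (m : ℕ) (hm : m ∣ n)
      (τm : ringClassField K ι m ≃ₐ[ℚ] ringClassField K ι m),
      (∀ x : ringClassField K ι m, ((τm x : ringClassField K ι m) : ℂ) = starRingEnd ℂ x) →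
      ∃ σ' ∈ ringClassGal ι m, IsOfFinAddOrder
        (pointGalHom W (ringClassField K ι m) τm (d m hm).y -
          (-W.rootNumber) • pointGalHom W (ringClassField K ι m) σ' (d m hm).y))
    (hGZ : ∀ [W.IsElliptic] (_hK : IsImaginaryQuadratic K) (_hH : SatisfiesHeegnerHypothesis N K)
      (Dt : ModularParametrizationData W N) (β : ℤ) (ι : K →+* ℂ) {M : ℕ} (_hM : 1 ≤ M) {n : ℕ}
      (_hn : Squarefree n)
      (_hKol : ∀ q ∈ n.primeFactors, IsKolyvaginPrime N W K 2 q ∧ FrobEqFrobInfty W K (2 ^ M) q)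
      (d : (m : ℕ) → m ∣ n → KolyvaginHeegnerData Dt β ι m),
      ∃ n' : ℤ, IsCoprime ((2 ^ M : ℕ) : ℤ) n' ∧
        ∀ (m : ℕ) (hm : m ∣ n) (γ : ringClassField K ι m ≃ₐ[ℚ] ringClassField K ι m),
          γ ∈ ringClassGal ι m → ∀ v : HeightOneSpectrum (𝓞 K),
            ¬ (W.baseChange K).HasGoodReductionAt v →
            n' • pointsMap (W.baseChange K) (v.adicCompletion K)
                ((d m hm).toGeomPoints (pointGalHom W (ringClassField K ι m) γ (d m hm).y)) ∈
              E0Receptacle (W.baseChange K) v ∧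
            ∀ (ℓ : ℕ) (hℓ : ℓ ∈ m.primeFactors)
              (hle : ringClassField K ι (m / ℓ) ≤ ringClassField K ι m),
              n' • pointsMap (W.baseChange K) (v.adicCompletion K)
                  ((d m hm).toGeomPoints (pointGalHom W (ringClassField K ι m) γ
                    (WeierstrassCurve.Affine.Point.map (W' := W)
                      ((RingClassField.inclusion ι hle).restrictScalars ℚ)
                      (d (m / ℓ)
                        ((Nat.div_dvd_of_dvd (Nat.dvd_of_mem_primeFactors hℓ)).trans hm)).y))) ∈
                E0Receptacle (W.baseChange K) v)
    (hγ : ∀ [W.IsElliptic] (_hK : IsImaginaryQuadratic K) (_hH : SatisfiesHeegnerHypothesis N K)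
      (Dt : ModularParametrizationData W N) (β : ℤ) (ι : K →+* ℂ) {M : ℕ}
      (_hM : 1 ≤ M) {n : ℕ} (_hn : Squarefree n)
      (_hKol : ∀ q ∈ n.primeFactors, IsKolyvaginPrime N W K 2 q ∧ FrobEqFrobInfty W K (2 ^ M) q)
      (d : (m : ℕ) → m ∣ n → KolyvaginHeegnerData Dt β ι m)
      (m : ℕ) (hm : m ∣ n) (ℓ : ℕ) (hℓ : ℓ ∈ m.primeFactors) [Fact ℓ.Prime]
      (hΔ : ¬ (ℓ : ℤ) ∣ minimalDiscriminantInt W) (φ₀ : absoluteGaloisGroup (ZMod ℓ)),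
      (∀ x : AlgebraicClosure (ZMod ℓ), φ₀ • x = x ^ ℓ) →
      ∀ (hle : ringClassField K ι (m / ℓ) ≤ ringClassField K ι m)
        (γ : ringClassField K ι m ≃ₐ[ℚ] ringClassField K ι m), γ ∈ ringClassGal ι m →
        geomReduction hΔ ((RatClosure.pointsEquiv (K := K) W).symm
            ((d m hm).toGeomPoints (pointGalHom W (ringClassField K ι m) γ (d m hm).y))) =
          φ₀ • geomReduction hΔ ((RatClosure.pointsEquiv (K := K) W).symm
            ((d m hm).toGeomPoints (pointGalHom W (ringClassField K ι m) γ
              (WeierstrassCurve.Affine.Point.map (W' := W)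
                ((RingClassField.inclusion ι hle).restrictScalars ℚ)
                (d (m / ℓ)
                  ((Nat.div_dvd_of_dvd (Nat.dvd_of_mem_primeFactors hℓ)).trans hm)).y))))) :
    ∃ (M₀ : ℕ) (x₀ : (W.baseChange K).toAffine.Point),
      2 ^ M₀ • x₀ = P ∧ (∀ Q : (W.baseChange K).toAffine.Point, 2 ^ (M₀ + 1) • Q ≠ P) ∧
      (∀ cs : (W.baseChange K).sha, (∃ j : ℕ, 2 ^ j • cs = 0) → 2 ^ (M₀ + 2) • cs = 0) ∧
      Set.Finite {cs : (W.baseChange K).sha | ∃ j : ℕ, 2 ^ j • cs = 0} := by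
  -- the Mordell model `C • W = y² = x³ − 432p²`, `∛(432p²) ∉ K`, `ω ∉ K`, `E_p(K)[2] = 0`
  obtain ⟨C, hCW⟩ := hW
  have hCW' : C • W = ⟨0, 0, 0, 0, -(432 * (p : ℚ) ^ 2)⟩ := by
    rw [hCW, HuShuYin2019.cubeSumCurve]; congr 1; ring
  have hcube : ∀ x : K, x ^ 3 ≠ ((432 * (p : ℚ) ^ 2 : ℚ) : K) := fun x h =>
    SylvesterTwoFrame.cube_ne_432_mul_sq_of_finrank_eq_two K hK.1 hp hp2 x (by rw [h]; simp)
  have hA2 : ∀ a : (W.baseChange K).toAffine.Point, 2 • a = 0 → a = 0 :=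
    SylvesterTwoFrame.two_torsion_eq_zero_of_model_of_isImaginaryQuadratic K hK hp hp2 W ⟨C, hCW⟩
  have hωK : ∀ x : K, x ^ 2 + x + 1 ≠ 0 := sq_add_self_add_one_ne_zero_of_discr_ne hK hD34.1
  exact sha_two_primary_exponent_sharp_of_pointsM_of_reciprocityFinsetM (N := N) W hK hCW' hcube hωK
    hA2 hHP hnt
    (fun {M} hM hdiv c hc ↦ hpoints_at_two_of_perLevelChoice_HSY hN hK hD34 hH hHP hp hp2 h9 ⟨C, hCW⟩
      hrec hCM h53 hGZ hγ hM hdiv c hc)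
    (fun {M} hM {ℓ} hℓ hℓM ↦ kolyvaginReciprocityFinsetM_of_poitouTate_anyPrime N W K hPT hK hD34 hH
      hHP hnt Nat.prime_two hM hℓ hℓM)

/-- **The same over `ℚ` in a twist-rank-`0` frame** on 𝒞_HSY, SHARP (`2^{M₀+2}`): transport along
`Ш(E_p/ℚ) ↪ Ш(E_p/K)` (`shaRestriction_injective_sylvester_of_twist_rank_zero`).  By the frame identity
`2M₀ = ord₂ #Ш_an(E_p) + ord₂ #Ш_an(E_p^{(d_K)}) + 2t_K` this misses stub (U1)'s `2e ≤ ord₂ #Ш_an(E_p)` by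
`4 + ord₂ #Ш_an(E_p^{(d_K)}) + 2t_K` — the line's typed distance to (U1) after this seat's sharpening.
[cite: McCallumLMS1991, §1 Theorem (Kolyvagin)] [cite: GrossLMS1991, Thm. 1.3 (2), §2] -/
theorem sha_two_primary_exponent_sharp_HSY_rat_of_poitouTate [NeZero N]
    [W.IsGloballyMinimal] [W.IsElliptic]
    (hN : N = W.conductorNorm ℤ) (hK : IsImaginaryQuadratic K)
    (hD34 : NumberField.discr K ≠ -3 ∧ NumberField.discr K ≠ -4)
    (hH : SatisfiesHeegnerHypothesis N K) {P : (W.baseChange K).toAffine.Point}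
    (hHP : IsHeegnerPoint N W K P) (hnt : ¬ IsOfFinAddOrder P) {p : ℕ} (hp : p.Prime) (hp2 : p ≠ 2)
    (h9 : p % 9 = 4 ∨ p % 9 = 7)
    (hW : ∃ C : VariableChange ℚ, C • W = HuShuYin2019.cubeSumCurve (p : ℚ))
    (htwist : (W.quadraticTwist (NumberField.discr K : ℚ)).mordellWeilRank = 0)
    (hPT : poitouTate_sum_localTatePairing_eq_zero K)
    (hrec : heegnerPointOfConductor_one_galoisConj N W K)
    (hCM : ∀ [W.IsElliptic] (_hK : IsImaginaryQuadratic K) (_hH : SatisfiesHeegnerHypothesis N K)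
      (Dt : ModularParametrizationData W N) (β : ℤ) (ι : K →+* ℂ),
      (4 * N : ℤ) ∣ β ^ 2 - NumberField.discr K →
      ∀ {M : ℕ}, 1 ≤ M → ∀ (m : ℕ), Squarefree m →
      (∀ q ∈ m.primeFactors, IsKolyvaginPrime N W K 2 q ∧ FrobEqFrobInfty W K (2 ^ M) q) →
      ∃ y : (W.baseChange (ringClassField K ι m)).toAffine.Point,
        WeierstrassCurve.Affine.Point.map (W' := W) (ringClassField K ι m).subtype.toRatAlgHom y =
          heegnerPointComplexOfConductor Dt (NumberField.discr K) β m)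
    (h53 : ∀ [W.IsElliptic] (_hK : IsImaginaryQuadratic K) (_hH : SatisfiesHeegnerHypothesis N K)
      (Dt : ModularParametrizationData W N) (β : ℤ) (ι : K →+* ℂ) {M : ℕ}
      (_hM : 1 ≤ M) {n : ℕ} (_hn : Squarefree n)
      (_hKol : ∀ q ∈ n.primeFactors, IsKolyvaginPrime N W K 2 q ∧ FrobEqFrobInfty W K (2 ^ M) q)
      (d : (m : ℕ) → m ∣ n → KolyvaginHeegnerData Dt β ι m) (m : ℕ) (hm : m ∣ n)
      (τm : ringClassField K ι m ≃ₐ[ℚ] ringClassField K ι m),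
      (∀ x : ringClassField K ι m, ((τm x : ringClassField K ι m) : ℂ) = starRingEnd ℂ x) →
      ∃ σ' ∈ ringClassGal ι m, IsOfFinAddOrder
        (pointGalHom W (ringClassField K ι m) τm (d m hm).y -
          (-W.rootNumber) • pointGalHom W (ringClassField K ι m) σ' (d m hm).y))
    (hGZ : ∀ [W.IsElliptic] (_hK : IsImaginaryQuadratic K) (_hH : SatisfiesHeegnerHypothesis N K)
      (Dt : ModularParametrizationData W N) (β : ℤ) (ι : K →+* ℂ) {M : ℕ} (_hM : 1 ≤ M) {n : ℕ}
      (_hn : Squarefree n)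
      (_hKol : ∀ q ∈ n.primeFactors, IsKolyvaginPrime N W K 2 q ∧ FrobEqFrobInfty W K (2 ^ M) q)
      (d : (m : ℕ) → m ∣ n → KolyvaginHeegnerData Dt β ι m),
      ∃ n' : ℤ, IsCoprime ((2 ^ M : ℕ) : ℤ) n' ∧
        ∀ (m : ℕ) (hm : m ∣ n) (γ : ringClassField K ι m ≃ₐ[ℚ] ringClassField K ι m),
          γ ∈ ringClassGal ι m → ∀ v : HeightOneSpectrum (𝓞 K),
            ¬ (W.baseChange K).HasGoodReductionAt v →
            n' • pointsMap (W.baseChange K) (v.adicCompletion K)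
                ((d m hm).toGeomPoints (pointGalHom W (ringClassField K ι m) γ (d m hm).y)) ∈
              E0Receptacle (W.baseChange K) v ∧
            ∀ (ℓ : ℕ) (hℓ : ℓ ∈ m.primeFactors)
              (hle : ringClassField K ι (m / ℓ) ≤ ringClassField K ι m),
              n' • pointsMap (W.baseChange K) (v.adicCompletion K)
                  ((d m hm).toGeomPoints (pointGalHom W (ringClassField K ι m) γ
                    (WeierstrassCurve.Affine.Point.map (W' := W)
                      ((RingClassField.inclusion ι hle).restrictScalars ℚ)
                      (d (m / ℓ)
                        ((Nat.div_dvd_of_dvd (Nat.dvd_of_mem_primeFactors hℓ)).trans hm)).y))) ∈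
                E0Receptacle (W.baseChange K) v)
    (hγ : ∀ [W.IsElliptic] (_hK : IsImaginaryQuadratic K) (_hH : SatisfiesHeegnerHypothesis N K)
      (Dt : ModularParametrizationData W N) (β : ℤ) (ι : K →+* ℂ) {M : ℕ}
      (_hM : 1 ≤ M) {n : ℕ} (_hn : Squarefree n)
      (_hKol : ∀ q ∈ n.primeFactors, IsKolyvaginPrime N W K 2 q ∧ FrobEqFrobInfty W K (2 ^ M) q)
      (d : (m : ℕ) → m ∣ n → KolyvaginHeegnerData Dt β ι m)
      (m : ℕ) (hm : m ∣ n) (ℓ : ℕ) (hℓ : ℓ ∈ m.primeFactors) [Fact ℓ.Prime]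
      (hΔ : ¬ (ℓ : ℤ) ∣ minimalDiscriminantInt W) (φ₀ : absoluteGaloisGroup (ZMod ℓ)),
      (∀ x : AlgebraicClosure (ZMod ℓ), φ₀ • x = x ^ ℓ) →
      ∀ (hle : ringClassField K ι (m / ℓ) ≤ ringClassField K ι m)
        (γ : ringClassField K ι m ≃ₐ[ℚ] ringClassField K ι m), γ ∈ ringClassGal ι m →
        geomReduction hΔ ((RatClosure.pointsEquiv (K := K) W).symm
            ((d m hm).toGeomPoints (pointGalHom W (ringClassField K ι m) γ (d m hm).y))) =
          φ₀ • geomReduction hΔ ((RatClosure.pointsEquiv (K := K) W).symm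
            ((d m hm).toGeomPoints (pointGalHom W (ringClassField K ι m) γ
              (WeierstrassCurve.Affine.Point.map (W' := W)
                ((RingClassField.inclusion ι hle).restrictScalars ℚ)
                (d (m / ℓ)
                  ((Nat.div_dvd_of_dvd (Nat.dvd_of_mem_primeFactors hℓ)).trans hm)).y))))) :
    ∃ (M₀ : ℕ) (x₀ : (W.baseChange K).toAffine.Point),
      2 ^ M₀ • x₀ = P ∧ (∀ Q : (W.baseChange K).toAffine.Point, 2 ^ (M₀ + 1) • Q ≠ P) ∧
      (∀ cs : W.sha, (∃ j : ℕ, 2 ^ j • cs = 0) → 2 ^ (M₀ + 2) • cs = 0) ∧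
      Set.Finite {cs : W.sha | ∃ j : ℕ, 2 ^ j • cs = 0} := by
  obtain ⟨M₀, x₀, hx₀, hmax, hkill, hfin⟩ :=
    sha_two_primary_exponent_sharp_HSY_of_poitouTate hN hK hD34 hH hHP hnt hp hp2 h9 hW hPT hrec hCM h53
      hGZ hγ
  have hinj : Function.Injective (shaRestriction W K) :=
    shaRestriction_injective_sylvester_of_twist_rank_zero hp hp2 W hW K hK.1 htwist
  obtain ⟨hkillQ, hfinQ⟩ :=
    twoPrimary_exponent_of_injective (shaRestriction W K) hinj 2 (M₀ + 2) hkill hfin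
  exact ⟨M₀, x₀, hx₀, hmax, hkillQ, hfinQ⟩

end Summit.BirchSwinnertonDyer.BirchSwinnertonDyer.Theorems.SylvesterTwoUpper

end
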